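import Summits.BirchSwinnertonDyer.Rank1Residual.Additive.X4RankOneKimKatoConsistencyBudget
import Summits.BirchSwinnertonDyer.Rank1Residual.Additive.X4RankOneKimKatoConsistencyBudgetPotMult
import HarnessLib

/-!
# KURREG register ADDENDUM A5 (index-`n₀` claims): the RECORD-LITERAL row shapes — every hypothesis is
# a joint-table column (Q6 record at `n₀`, valuation record `v₁`, budget, one Kurihara number, the
# (B)-height datum) or a published fact; the twist datum is DISCHARGED — part 1: `p ≥ 5`
# (sequel `CensusKurregRecordRowsThree.lean`: `p = 3`)
# (cell `b2b-bsdres`, census cell, seat `b2b-bsdres-census-ctyper1` = conjecture-typer 1 /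
# KURREG joint-table owner, gen 5)

HONEST FRAMING (cell `b2b-bsdres`, run/shared/lean/b2b/bsd-rank1-residual/, verbatim in every
file): the goal of the cell is to DELETE the COMBINATION-SHAPED residual classes of the
Birch–Swinnerton-Dyer formula for ALL analytic-rank `≤ 1` elliptic curves over `ℚ` — "full BSD
formula for every rank `≤ 1` curve in class `C`" assembled STRICTLY from published theorems — so
that the rank-`≤ 1` remainder becomes exactly the CONSTRUCTION-SHAPED classes, which are TYPED
(missing-input `Prop`s), NOT attempted. This is not "finishing BSD". Census cell: research
instrumentation; census / instrument output (Q6 records, Kurihara numbers, `p`-adic heights) =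
EVIDENCE / per-pair CERTIFICATE-EVIDENCE for the kernel cell, never a Literature fact; nothing
booked; no mark / label moved (O7-ord OPEN; X3♯/X4♯ CONSTRUCTION-SHAPED). Theorems only (no `def`,
no named fact); every theorem is an implication from published facts (`hE73` = Kim, `hKato` = Kato
17.4 (3), GZK, modularity, `hmodD`) and per-pair records; at `p = 3` additionally OUR `∂`-clause
conjecture `X4SharpThreeKimRankOnePartial` (typed, not asserted) and, where named, Kim's Conjecture
1.10 at the pair (`X4.KimTamagawaDefectAt`, `@[conjecture]`, a HYPOTHESIS).

## What and why

`cells/n1011/PREDICTIONS-KURREG.md` §9 ADDENDUM A5 (n1011-p17 GEN 2, 2026-08-21T10:05Z, pre-data)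
registered the index-`n₀` claims K0-n₀ / K2-n₀ (`p ≥ 5`) and K1-n₀ / K1-M-n₀ (`p = 3`) with the
joint-table columns `n0` (the Q6 first-unit-index RECORD `CensusQ6.{Gord,GordOdd,Mult,MultOdd}FirstUnitIndexAt
W p n₀`), `v1` (the valuation RECORD `CensusQ6.GordCoeffValAt W p 1 v₁` / `MultCoeffValAt`, census-ctyper1
p258170) and `budget_ok` (`BudgetLeLambdaAt p W n₀`). The kernels are n1011-p17's p260318
(`X4RankOneKimKatoConsistencyBudget.lean`) and p260326 (`…BudgetPotMult.lean`). Of those, only the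
`p ≥ 5` (G-ord) gap identity and the `p ≥ 5` (M) gap identity are printed in CENSUS-LITERAL form
(twist datum discharged, `v₁` read off the record); the (G-ord) form still takes the index-`n₀`
CERTIFICATE `BranchUnitCoeffAt W p n₀` rather than the Q6 record, and the `p = 3` forms and all the
Conjecture-1.10 forms keep the twist-model binders `V, C, f, ϖ, hne₁` and the raw valuation term.
This file and its sequel close that bookkeeping gap so that EVERY A5 claim has a kernel theorem whose
hypotheses are exactly the joint-table columns (ASSEMBLY-SPEC v0.3 §3-n₀ cites them by name); this
part = `p ≥ 5`, the sequel `CensusKurregRecordRowsThree.lean` = `p = 3`: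

| A5 claim (register §9) | rows | theorem (this file / sequel) | identity |
|---|---|---|---|
| K0-n₀ (G-ord), `p ≥ 5` | X4♯(G-ord) `e = 2`, surj, `r_an = 1` | `ClassX4Gord.kuriharaGap_identity_rankOne_…_of_gordFirstUnitIndexRecord_of_gordCoeffValAt_of_budget_of_five_le` | `∂¹ − ∂^∞ + vReg + ord ∏c + ord ℓ = v₁ + 1 + 2 ord #tors` |
| K2-n₀ (G-ord), `p ≥ 5` (+ Conj 1.10) | same | `ClassX4Gord.kuriharaPartial_one_identity_rankOne_…_of_tamagawaDefect_of_gordFirstUnitIndexRecord_…` | `∂¹ + vReg + ord ℓ = v₁ + 1` |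
| K2-n₀ (M), `p ≥ 5` (+ Conj 1.10) | X4(M), surj, `r_an = 1` | `ClassX4M.kuriharaPartial_one_identity_rankOne_…_of_tamagawaDefect_of_multCoeffValAt_of_budget_of_five_le` | `∂¹ + vReg = v₁ + 1` |
| K1-n₀ (G-ord) / K1-M-n₀, `p = 3` (gap form; + Conj 1.10; non-anomalous) | Gord3 ∩ surj(3) / (M)@3 ∩ surj, `r_an = 1` | sequel `CensusKurregRecordRowsThree.lean` | `∂¹ − ∂^∞ + vReg₃ + ord₃ ∏c (+ ord₃ ℓ) = v₁ + 1 + 2 ord₃ #tors`; `∂¹ + vReg₃ (+ ord₃ ℓ) = v₁ + 1` |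

All over p17's theorems BY NAME; the only new steps here are (a) the parity-split (G-ord) record ⟹ the
index-`n₀` certificate at every odd `p` (census-ctyper1's interlocks
`CensusQ6.branchUnitCoeffAt_of_gord[Odd]FirstUnitIndexAt`, p258170) and (b) Conjecture 1.10 at the pair
substituted (`∂^∞ = ord ∏c`, `p ∤ #E(ℚ)_tors` from irreducibility). Per pair; EVIDENCE-conditional in
its record binders; nothing about any curve is asserted; nothing booked.

References: [Kim2022StructureSelmer] Thm. 1.9 (6), Conj. 1.10 (PDF p. 8); [Kato2004Asterisque] Thm.
17.4 (3) (p. 273); [Delbourgo2002] Thm. (B) (p. 40); [MazurTateTeitelbaum1986Invent] §I.10, §I.13 (the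
branch series of the records; nothing asserted). Cell files: cells/n1011/PREDICTIONS-KURREG.md §9 A5;
HOME/b2b-bsdres-n1011-p17/KURREG-KERNELS.md; HOME/b2b-bsdres-census-ctyper1/kurreg/ASSEMBLY-SPEC.md.
-/

set_option autoImplicit false

noncomputable section

open scoped Classical MatrixGroups ModularForm NumberField

open CongruenceSubgroup WeierstrassCurve NumberField Literature.NumberTheory.EllipticCurves
  Literature.NumberTheory.EllipticCurves.ModularForms
  Literature.NumberTheory.EllipticCurves.Rank1Residual
  Literature.NumberTheory.EllipticCurves.Rank1Residual.Typed
  Literature.NumberTheory.EllipticCurves.Delbourgo2002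
  Literature.NumberTheory.GaloisRepresentations
  Summit.BirchSwinnertonDyer.Rank1Residual.AdditivePotMult
  IsDedekindDomain

namespace Summit.BirchSwinnertonDyer.Rank1Residual.Additive

/-! ### §0 The parity-split (G-ord) Q6 record IS the index-`n₀` certificate (any odd `p`) -/

section Record

variable {W : WeierstrassCurve ℚ} {p : ℕ} [hp : Fact p.Prime]

/-- **Column `n0` (G-ord) ⟹ Route G's index-`n₀` certificate**: the parity-split Q6 first-unit-index
record (`GordFirstUnitIndexAt` at `p ≡ 1 (mod 4)`, `GordOddFirstUnitIndexAt` at `p ≡ 3 (mod 4)` — the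
shape of n1011-p17's (M) binder `hrec`) gives `BranchUnitCoeffAt W p n₀` at every odd `p`, by
census-ctyper1's interlocks (p258170). [cite: MazurTateTeitelbaum1986Invent, §I.13 (the record; nothing asserted)] -/
theorem CensusQ6.branchUnitCoeffAt_of_firstUnitIndexRecord (hp2 : p ≠ 2) {n₀ : ℕ}
    (hrec : (p % 4 = 1 → CensusQ6.GordFirstUnitIndexAt W p n₀) ∧
      (p % 4 = 3 → CensusQ6.GordOddFirstUnitIndexAt W p n₀)) :
    BranchUnitCoeffAt W p n₀ := by
  rcases hp.out.eq_two_or_odd with h2 | hodd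
  · exact absurd h2 hp2
  · by_cases h1 : p % 4 = 1
    · exact CensusQ6.branchUnitCoeffAt_of_gordFirstUnitIndexAt h1 (hrec.1 h1)
    · have h3 : p % 4 = 3 := by omega
      exact CensusQ6.branchUnitCoeffAt_of_gordOddFirstUnitIndexAt h3 (hrec.2 h3)

end Record

/-! ### §1 `p ≥ 5`, (G-ord): K0-n₀ and K2-n₀ in RECORD-LITERAL form -/

section FiveLe

variable {W : WeierstrassCurve ℚ} [W.IsElliptic] [W.IsGloballyMinimal] {p : ℕ} [hp : Fact p.Prime]

/-- **K0-n₀ (G-ord), `p ≥ 5`, RECORD-LITERAL** (the KURREG row shape of register A5): X4♯(G-ord) ∩ `I₀*` ∩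
{`ρ̄` onto}, `r_an = 1`, Q6 RECORD at index `n₀` (column `n0`, parity-split) + budget `n₀ ≤ λ` (column
`budget_ok`) + valuation RECORD at index `1` (column `v1`) + a (B)-datum + a parametrisation datum with ONE
non-zero Kurihara number: **`∂^{(1)} − ∂^{(∞)} + v(Reg_p(E,Dh)) + ord_p ∏c + ord_p ℓ = v₁ + 1 + 2·ord_p #E(ℚ)_tors`**
(`ℓ ∣ p²`, `ℓ = 1` off the anomalous rows). Over p17's census-literal theorem BY NAME, the record turned
into the certificate by §0. NO conjecture; per pair; nothing booked.
[cite: Kim2022StructureSelmer, Thm. 1.9 (6) (PDF p. 8)] [cite: Kato2004Asterisque, Thm. 17.4 (3) (p. 273)]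
[cite: Delbourgo2002, Theorem (B) (p. 40)] -/
theorem ClassX4Gord.kuriharaGap_identity_rankOne_of_kim2026_of_katoHalf_of_gordFirstUnitIndexRecord_of_gordCoeffValAt_of_budget_of_five_le
    (hE73 : Kim2026.kuriharaPartial_vanishingOrder_eq_padicValNat_sha_add_partialInfty_of_maninConstant)
    (hKato : Wuthrich2014.kato_halfEigenCharIdeal_dvd_cyclotomicPrime_of_surjective)
    (hmodD : nonempty_modularParametrizationData)
    (hGZK : rank_eq_analyticRank_of_analyticRank_le_one) (hmod : hasEntireLFunction_rat)
    (hX : ClassX4Gord W p) (hp5 : 5 ≤ p) (he : semistabilityIndex W p = 2) (hsurj : Surj W p)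
    (hr : W.analyticRank = 1) {n₀ : ℕ}
    (hrec : (p % 4 = 1 → CensusQ6.GordFirstUnitIndexAt W p n₀) ∧
      (p % 4 = 3 → CensusQ6.GordOddFirstUnitIndexAt W p n₀))
    (hbud : BudgetLeLambdaAt p W n₀) {v₁ : ℤ} (hv1 : CensusQ6.GordCoeffValAt W p 1 v₁)
    {Dh : PAdicHeightData W p} (hB : LeadingTermClauses W p Dh)
    {N : ℕ} [NeZero N] (D : ModularParametrizationData W N) (hc : ¬ (p : ℤ) ∣ D.maninConstant)
    (hper : ∃ u : ℚ, ‖(u : ℚ_[p])‖ = 1 ∧ W.realPeriodRat = u * plusPeriod D.f)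
    (hne : kuriharaPartial W p D.f 1 ≠ ⊤) :
    ∃ ℓ : ℕ, ℓ ∣ p ^ 2 ∧ (ReductionNonAnomalous W p → ℓ = 1) ∧
      ∃ m d : ℕ, kuriharaPartial W p D.f 1 = m ∧ kuriharaPartialInfty W p D.f = d ∧
        (m : ℤ) - d + (padicRegulator Dh).valuation + padicValNat p W.tamagawaProduct + padicValNat p ℓ =
          v₁ + 1 + 2 * padicValNat p W.torsionOrder :=
  have hp2 : p ≠ 2 := by omega
  hX.kuriharaGap_identity_rankOne_of_kim2026_of_katoHalf_of_gordCoeffValAt_of_budget_of_five_le hE73 hKato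
    hmodD hGZK hmod hp5 he hsurj hr (CensusQ6.branchUnitCoeffAt_of_firstUnitIndexRecord hp2 hrec) hbud hv1
    hB D hc hper hne

/-- **K2-n₀ (G-ord), `p ≥ 5`, RECORD-LITERAL, WITH Kim's Conjecture 1.10 at the pair** (`hT : ∂^{(∞)} = ord_p ∏c`,
a HYPOTHESIS): **`∂^{(1)} + v(Reg_p(E,Dh)) + ord_p ℓ = v₁ + 1`** (`p ∤ #E(ℚ)_tors` from irreducibility).
The register's BSD-free falsification handle for Conj. 1.10 on the budget rows, in the columns of the
joint table. Per pair; nothing booked.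
[cite: Kim2022StructureSelmer, Thm. 1.9 (6), Conj. 1.10 (PDF p. 8)] [cite: Kato2004Asterisque, Thm. 17.4 (3) (p. 273)]
[cite: Delbourgo2002, Theorem (B) (p. 40)] -/
theorem ClassX4Gord.kuriharaPartial_one_identity_rankOne_of_kim2026_of_tamagawaDefect_of_gordFirstUnitIndexRecord_of_gordCoeffValAt_of_budget_of_five_le
    (hE73 : Kim2026.kuriharaPartial_vanishingOrder_eq_padicValNat_sha_add_partialInfty_of_maninConstant)
    (hKato : Wuthrich2014.kato_halfEigenCharIdeal_dvd_cyclotomicPrime_of_surjective)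
    (hmodD : nonempty_modularParametrizationData)
    (hGZK : rank_eq_analyticRank_of_analyticRank_le_one) (hmod : hasEntireLFunction_rat)
    (hX : ClassX4Gord W p) (hp5 : 5 ≤ p) (he : semistabilityIndex W p = 2) (hsurj : Surj W p)
    (hr : W.analyticRank = 1) {n₀ : ℕ}
    (hrec : (p % 4 = 1 → CensusQ6.GordFirstUnitIndexAt W p n₀) ∧
      (p % 4 = 3 → CensusQ6.GordOddFirstUnitIndexAt W p n₀))
    (hbud : BudgetLeLambdaAt p W n₀) {v₁ : ℤ} (hv1 : CensusQ6.GordCoeffValAt W p 1 v₁)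
    {Dh : PAdicHeightData W p} (hB : LeadingTermClauses W p Dh)
    {N : ℕ} [NeZero N] (D : ModularParametrizationData W N) (hc : ¬ (p : ℤ) ∣ D.maninConstant)
    (hper : ∃ u : ℚ, ‖(u : ℚ_[p])‖ = 1 ∧ W.realPeriodRat = u * plusPeriod D.f)
    (hne : kuriharaPartial W p D.f 1 ≠ ⊤) (hT : X4.KimTamagawaDefectAt W p D.f) :
    ∃ ℓ : ℕ, ℓ ∣ p ^ 2 ∧ (ReductionNonAnomalous W p → ℓ = 1) ∧
      ∃ m : ℕ, kuriharaPartial W p D.f 1 = m ∧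
        (m : ℤ) + (padicRegulator Dh).valuation + padicValNat p ℓ = v₁ + 1 := by
  obtain ⟨ℓ, hℓ, hℓ1, m, d, hm, hd, hid⟩ :=
    hX.kuriharaGap_identity_rankOne_of_kim2026_of_katoHalf_of_gordFirstUnitIndexRecord_of_gordCoeffValAt_of_budget_of_five_le
      hE73 hKato hmodD hGZK hmod hp5 he hsurj hr hrec hbud hv1 hB D hc hper hne
  have htors0 : padicValNat p W.torsionOrder = 0 :=
    padicValNat_torsionOrder_eq_zero_of_irreducible W p hX.1.2.2
  unfold X4.KimTamagawaDefectAt at hT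
  have hdT : (d : ℕ∞) = (padicValNat p W.tamagawaProduct : ℕ∞) := hd.symm.trans hT
  have hdT' : d = padicValNat p W.tamagawaProduct := by exact_mod_cast hdT
  refine ⟨ℓ, hℓ, hℓ1, m, hm, ?_⟩
  rw [htors0, hdT'] at hid
  simp only [Nat.cast_zero, mul_zero, add_zero] at hid
  linarith

end FiveLe

end Summit.BirchSwinnertonDyer.Rank1Residual.Additive

/-! ### §2 The (M) rows, `p ≥ 5`: K2-n₀ in RECORD-LITERAL form -/

namespace Summit.BirchSwinnertonDyer.Rank1Residual.AdditivePotMult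

open CongruenceSubgroup WeierstrassCurve NumberField Literature.NumberTheory.EllipticCurves
  Literature.NumberTheory.EllipticCurves.ModularForms
  Literature.NumberTheory.EllipticCurves.Rank1Residual
  Literature.NumberTheory.EllipticCurves.Rank1Residual.Typed
  Literature.NumberTheory.EllipticCurves.Delbourgo2002
  Literature.NumberTheory.GaloisRepresentations
  Summit.BirchSwinnertonDyer.Rank1Residual.Additive
  IsDedekindDomain

section FiveLe

variable {W : WeierstrassCurve ℚ} [W.IsElliptic] [W.IsGloballyMinimal] {p : ℕ} [hp : Fact p.Prime]

/-- **K2-n₀ (M), `p ≥ 5`, RECORD-LITERAL, WITH Kim's Conjecture 1.10 at the pair** (`hT`, a HYPOTHESIS):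
X4(M) ∩ {`ρ̄` onto}, `r_an = 1`, Q6 (M) record at `n₀` (column `n0`) + budget + (M) valuation record
`CensusQ6.MultCoeffValAt W p 1 v₁` (column `v1`): **`∂^{(1)} + v(Reg_p(E,Dh)) = v₁ + 1`** (no `ℓ` on (M);
`p ∤ #E(ℚ)_tors`). Over p17's census-literal (M) gap identity BY NAME. Per pair; nothing booked.
[cite: Kim2022StructureSelmer, Thm. 1.9 (6), Conj. 1.10 (PDF p. 8)] [cite: Kato2004Asterisque, Thm. 17.4 (3) (p. 273)]
[cite: Delbourgo2002, Theorem (B) (p. 40)] -/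
theorem ClassX4M.kuriharaPartial_one_identity_rankOne_of_kim2026_of_tamagawaDefect_of_multCoeffValAt_of_budget_of_five_le
    (hE73 : Kim2026.kuriharaPartial_vanishingOrder_eq_padicValNat_sha_add_partialInfty_of_maninConstant)
    (hKato : Wuthrich2014.kato_halfEigenCharIdeal_dvd_cyclotomicPrime_of_surjective)
    (hmodD : nonempty_modularParametrizationData)
    (hGZK : rank_eq_analyticRank_of_analyticRank_le_one) (hmod : hasEntireLFunction_rat)
    (hX : ClassX4M W p) (hp5 : 5 ≤ p) (hsurj : Surj W p) (hr : W.analyticRank = 1) {n₀ : ℕ}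
    (hrec : (p % 4 = 1 → CensusQ6.MultFirstUnitIndexAt W p n₀) ∧
      (p % 4 = 3 → CensusQ6.MultOddFirstUnitIndexAt W p n₀))
    (hbud : BudgetLeLambdaAt p W n₀) {v₁ : ℤ} (hv1 : CensusQ6.MultCoeffValAt W p 1 v₁)
    {Dh : PAdicHeightData W p} (hB : LeadingTermClauses W p Dh)
    {N : ℕ} [NeZero N] (D : ModularParametrizationData W N) (hc : ¬ (p : ℤ) ∣ D.maninConstant)
    (hper : ∃ u : ℚ, ‖(u : ℚ_[p])‖ = 1 ∧ W.realPeriodRat = u * plusPeriod D.f)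
    (hne : kuriharaPartial W p D.f 1 ≠ ⊤) (hT : X4.KimTamagawaDefectAt W p D.f) :
    ∃ m : ℕ, kuriharaPartial W p D.f 1 = m ∧ (m : ℤ) + (padicRegulator Dh).valuation = v₁ + 1 := by
  obtain ⟨m, d, hm, hd, hid⟩ :=
    hX.kuriharaGap_identity_rankOne_of_kim2026_of_katoHalf_of_multCoeffValAt_of_budget_of_five_le hE73 hKato
      hmodD hGZK hmod hp5 hsurj hr hrec hbud hv1 hB D hc hper hne
  have htors0 : padicValNat p W.torsionOrder = 0 :=
    padicValNat_torsionOrder_eq_zero_of_irreducible W p hX.classX4.2.2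
  unfold X4.KimTamagawaDefectAt at hT
  have hdT : (d : ℕ∞) = (padicValNat p W.tamagawaProduct : ℕ∞) := hd.symm.trans hT
  have hdT' : d = padicValNat p W.tamagawaProduct := by exact_mod_cast hdT
  refine ⟨m, hm, ?_⟩
  rw [htors0, hdT'] at hid
  simp only [Nat.cast_zero, mul_zero, add_zero] at hid
  linarith

end FiveLe

end Summit.BirchSwinnertonDyer.Rank1Residual.AdditivePotMult
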